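import Summits.NavierStokesRegularity.NavierStokesRegularity.Theorems.ExtremiserTransienceBangBangCoreDefs
import HarnessLib

/-!
# Route `ExtremiserTransience`, crux `NearExtremalTransiencePerFlow` (stmt-NavierStokesRegularity-26567),
# LINE g9-1 «local maximiser» (ideator ns-idea-10 g9): THE VOCABULARY OF THE STUBS L1, L2 (texts of record)

Texts of record, VERBATIM §1 (the slice-level part) and §3 `Sig.LocalSlack` / `Sig.ThickGoodCentre` / `Sig.Selection` of
the critic-passed line file `Cruxes/NearExtremalTransience/Lines/local_maximiser.lean` (REV 3.0, crux-write f1b568f33667;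
idea-crit-8 V105 PASS; these declarations are byte-identical since REV 1.0 by the critic's defdiffs N121–N124), so that the
line's non-heart stubs L1 `stub_localSlack : Sig.LocalSlack` and L2 `stub_thickGoodCentre : Sig.ThickGoodCentre` can be
stated BY NAME in `Theorems/` files (a `Cruxes/` file is not importable from `Theorems/`).  The line concludes the crux
`Theses.ExtremiserTransience.NearExtremalTransiencePerFlow` ⟨stmt-26567⟩ BY NAME from its stubs.

* `sd`, `zd`, `wd` — the stretching / enstrophy / palinstrophy DENSITIES `⟪ω, Dv ω⟫`, `‖ω‖²`, `|∇ω|²_F` (`ω = curl v`);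
* `locGain κ μ V φ` — the local gain of the linearised functional `F̃ = J − (κ/2)(μ⁻¹ Z + μ W)` under `V ↦ V + φ`;
* `IsTestAt v M φ` — admissible local test at height `M` (smooth, compactly supported, divergence free, `‖v + φ‖ ≤ M` on
  `tsupport φ`);
* `LocalSlack` (L1, proved in the line file), `ThickGoodCentre` (L2), `Selection` (= L2 with L1's conclusion discharged;
  what L3 consumes).

Everything is phrased over the tree's `KStar.HalfSpace` vocabulary (`E3`, `kStar`, `Jst`, `Zen`, `Wpa`) and the route's
admissible / regular classes `KStar.BangBang.IsAdm`, `KStar.BangBang.IsReg`, `KStar.BangBang.lam` (landed `…BangBangCoreDefs`);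
nothing new is posited.  The LIMIT-CLASS vocabulary of the line (`IsTest`, `IsTestIn`, `IsLocMaxIn`, `HasLinearGrowth`,
`NearTopBounded`, `InLimitClass`, used by L3–L5) is deliberately NOT included here: REV 3.0 of the line is still moving it;
it is to be appended (append protocol) once frozen.

Author: prover seat `ns-net-p1` (g14).  HONEST FRAMING: definitions only; nothing about Navier–Stokes regularity or blow-up
is proved here; no summit is proved by a line.
-/

noncomputable section

open scoped Topology InnerProductSpace RealInnerProductSpace ENNReal ContDiff
open MeasureTheory Filter Set
open Literature.Analysis.FluidPDE
open Summit.NavierStokesRegularity.NavierStokesRegularity.Theorems.DepletionLadder.KStar.HalfSpace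
open Summit.NavierStokesRegularity.NavierStokesRegularity.Theorems.DepletionLadder.KStar.BangBang

namespace Summit.NavierStokesRegularity.NavierStokesRegularity.Theorems.NearExtremalTransiencePerFlow.LocalMaximiser

-- the problem directory repeats the summit name (`NavierStokesRegularity/NavierStokesRegularity`)
set_option linter.dupNamespace false

/-! ## §1 Densities, local gain, admissible local tests (verbatim the line's §1) -/

/-- Stretching density `ω·Dv ω` of a field `V` (`ω = curl V`). -/
def sd (V : E3 → E3) (x : E3) : ℝ := ⟪curl V x, fderiv ℝ V x (curl V x)⟫_ℝ

/-- Enstrophy density `|ω|²`. -/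
def zd (V : E3 → E3) (x : E3) : ℝ := ‖curl V x‖ ^ 2

/-- Palinstrophy density `|∇ω|²` (Frobenius norm squared of `D(curl V)`). -/
def wd (V : E3 → E3) (x : E3) : ℝ := frobeniusNormSq (fderiv ℝ (curl V) x)

/-- LOCAL GAIN of the linearised functional `F̃ = J − (κ/2)(μ⁻¹Z + μW)` under `V ↦ V + φ`; the integrand is supported in
`tsupport φ`, so the gain is meaningful for fields of infinite budget.  For an admissible `v` of height `M` and Taylor
length `λ = lam v` the relevant constants are `κ = κ⋆·M`, `μ = λ`. -/
def locGain (κ μ : ℝ) (V φ : E3 → E3) : ℝ :=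
  ∫ x, ((sd (V + φ) x - sd V x) - (κ / 2) * (μ⁻¹ * (zd (V + φ) x - zd V x) + μ * (wd (V + φ) x - wd V x)))

/-- ADMISSIBLE LOCAL TEST at height `M`: smooth, compactly supported, divergence free, and `‖v + φ‖ ≤ M` on `tsupport φ`
(off the support the field is unchanged). -/
def IsTestAt (v : E3 → E3) (M : ℝ) (φ : E3 → E3) : Prop :=
  ContDiff ℝ (⊤ : ℕ∞) φ ∧ HasCompactSupport φ ∧ VectorCalculus.IsDivFree φ ∧ ∀ x ∈ tsupport φ, ‖v x + φ x‖ ≤ M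

/-! ## §3 The statements L1, L2 and the derived `Selection` (verbatim the line's `Sig.*`) -/

/-- L1 · THE LOCAL SLACK INEQUALITY.  For admissible `v` of height `M`, positive budgets, `(κ⋆−ε)M√Z√W ≤ J(v)`, and finitely
many admissible local tests with pairwise disjoint supports, the local gains (constants `κ⋆M`, `λ = lam v`) sum to at most
the global defect `εM√Z√W`.  (Verbatim the line's `Sig.LocalSlack`; proved in the line file as `localSlack_holds`.) -/
def LocalSlack : Prop :=
  ∀ (v : E3 → E3) (M B ε : ℝ) (k : ℕ) (φ : Fin k → E3 → E3),
    IsAdm v M B → 0 < Zen v → 0 < Wpa v →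
    (kStar - ε) * M * Real.sqrt (Zen v) * Real.sqrt (Wpa v) ≤ Jst v →
    (∀ i, IsTestAt v M (φ i)) →
    (∀ i j, i ≠ j → Disjoint (tsupport (φ i)) (tsupport (φ j))) →
    ∑ i, locGain (kStar * M) (lam v) v (φ i) ≤ ε * M * Real.sqrt (Zen v) * Real.sqrt (Wpa v)

/-- L2 · THICK GOOD CENTRE from slack-summability.  In the `A`-regular admissible class there is `θ₀(A) > 0` such that for
every radius `R` and tolerance `η` some `ε₀(A,R,η) > 0` works: if the local gains of every disjoint admissible test family
sum to `≤ εM√Z√W` (the conclusion of L1) with `ε ≤ ε₀`, then some centre `x₀` carries THICK vorticity `‖curl v x₀‖ ≥ θ₀M/λ`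
and every admissible test inside `B(x₀, Rλ)` gains at most `ηM³`.  (Verbatim the line's `Sig.ThickGoodCentre`.) -/
def ThickGoodCentre : Prop :=
  ∀ A : ℕ → ℝ, (∀ j, 1 ≤ A j) → ∃ θ₀ : ℝ, 0 < θ₀ ∧ ∀ (R η : ℝ), 0 < R → 0 < η → ∃ ε₀ : ℝ, 0 < ε₀ ∧
    ∀ (v : E3 → E3) (M B ε : ℝ), IsAdm v M B → IsReg A v M → 0 < Zen v → 0 < Wpa v → 0 ≤ ε → ε ≤ ε₀ →
      (kStar - ε) * M * Real.sqrt (Zen v) * Real.sqrt (Wpa v) ≤ Jst v →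
      (∀ (k : ℕ) (φ : Fin k → E3 → E3), (∀ i, IsTestAt v M (φ i)) →
        (∀ i j, i ≠ j → Disjoint (tsupport (φ i)) (tsupport (φ j))) →
        ∑ i, locGain (kStar * M) (lam v) v (φ i) ≤ ε * M * Real.sqrt (Zen v) * Real.sqrt (Wpa v)) →
      ∃ x₀ : E3, θ₀ * M * (lam v)⁻¹ ≤ ‖curl v x₀‖ ∧
        ∀ φ : E3 → E3, IsTestAt v M φ → tsupport φ ⊆ Metric.ball x₀ (R * lam v) →
          locGain (kStar * M) (lam v) v φ ≤ η * M ^ 3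

/-- DERIVED (L1 + L2, `selection_of_localSlack` in `…LocalMaximiserThickGoodCentre`): the thick-good-centre SELECTION
with the slack hypothesis discharged — exactly what the line's L3 `Extraction` consumes.  (Verbatim the line's
`Sig.Selection`.) -/
def Selection : Prop :=
  ∀ A : ℕ → ℝ, (∀ j, 1 ≤ A j) → ∃ θ₀ : ℝ, 0 < θ₀ ∧ ∀ (R η : ℝ), 0 < R → 0 < η → ∃ ε₀ : ℝ, 0 < ε₀ ∧
    ∀ (v : E3 → E3) (M B ε : ℝ), IsAdm v M B → IsReg A v M → 0 < Zen v → 0 < Wpa v → 0 ≤ ε → ε ≤ ε₀ →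
      (kStar - ε) * M * Real.sqrt (Zen v) * Real.sqrt (Wpa v) ≤ Jst v →
      ∃ x₀ : E3, θ₀ * M * (lam v)⁻¹ ≤ ‖curl v x₀‖ ∧
        ∀ φ : E3 → E3, IsTestAt v M φ → tsupport φ ⊆ Metric.ball x₀ (R * lam v) →
          locGain (kStar * M) (lam v) v φ ≤ η * M ^ 3

end Summit.NavierStokesRegularity.NavierStokesRegularity.Theorems.NearExtremalTransiencePerFlow.LocalMaximiser

end
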